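import Mathlib.Analysis.Calculus.ContDiff.FiniteDimension
import Mathlib.Analysis.Analytic.Within
import Literature.Geometry.Lorentzian.ChartCalculus
import HarnessLib

/-!
# A chart metric with real-analytic components is a real-analytic metric

For a `C^n` pseudo-Riemannian metric `g` on an open subset `U : Opens E` of a finite-dimensional
real normed space (the setting of `ChartCalculus.lean`: `U` is a manifold modelled on `𝓘(ℝ, E)`
through its inclusion, hence trivially a `C^ω` manifold, and `g` is a `C^n` section of the bundle
of bilinear forms over `U`), whose coordinate components `p ↦ G p a b` (`g.val p = G p`) are
real-analytic on `U`, the SAME values `g.val` form a `C^ω` pseudo-Riemannian metric on `U`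
(`OpensChart.exists_analyticMetric_of_analyticOnNhd`).  This is the (trivial) regularity upgrade
"analytic components in one chart ⇒ analytic metric on that chart domain" by which an abstract
`C^∞` spacetime whose metric is analytic in suitable coordinates (e.g. the conclusion of Müller zum
Hagen's theorem, `ChartwiseAnalyticity.lean`) is fed to theorems about analytic pseudo-Riemannian
manifolds (Nomizu's extension theorem, `NomizuKillingExtension.lean`) — locally, on the chart.
Since the Levi-Civita connection only depends on the values of the metric
(`leviCivita_congr_of_val_eq`, `MetricValCongr.lean`), the upgraded metric has the same
connection, curvature and Killing equation as `g`.

* `analyticOnNhd_bilin_of_apply₂` — a map `G : E → (F →L[ℝ] F →L[ℝ] ℝ)` into bilinear forms on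
  a finite-dimensional space is analytic on an open set as soon as all its components
  `p ↦ G p a b` are (Mathlib's `contDiffOn_clm_apply` at exponent `ω`);
* `OpensChart.exists_analyticMetric_of_analyticOnNhd` — the upgrade.

Everything is proved (Mathlib calculus + `OpensChart.contMDiffAt_bilinSection_iff`); no
definitions, no named facts.

## References

* B. O'Neill, *Semi-Riemannian geometry with applications to relativity*, Academic Press 1983,
  Ch. 3, Def. 3.1 and Lemma 3.4 ff. (a metric tensor is smooth iff its components in every chart
  are). [ONeill1983]
-/

noncomputable section

open Set TopologicalSpace
open scoped ContDiff Manifold Topology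

namespace Literature.Geometry.Lorentzian

/-! ### Analyticity of a field of bilinear forms from its components -/

section Components

variable {E : Type*} [NormedAddCommGroup E] [NormedSpace ℝ E]
  {F : Type*} [NormedAddCommGroup F] [NormedSpace ℝ F] [FiniteDimensional ℝ F]

/-- **A field of bilinear forms on a finite-dimensional space is analytic iff its components
are.** If every component `p ↦ G p a b` of `G : E → (F →L[ℝ] F →L[ℝ] ℝ)` is real-analytic on the
open set `s`, then so is `G` (on an open set, analyticity is `C^ω` regularity, which for maps into
a space of continuous linear maps on a finite-dimensional space is checked after evaluation,
Mathlib's `contDiffOn_clm_apply`, twice). O'Neill 1983, Ch. 3, Lemma 3.4 ff. (componentwise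
regularity of tensor fields). [folklore] -/
theorem analyticOnNhd_bilin_of_apply₂ {G : E → F →L[ℝ] F →L[ℝ] ℝ} {s : Set E} (hs : IsOpen s)
    (h : ∀ a b : F, AnalyticOnNhd ℝ (fun p ↦ G p a b) s) : AnalyticOnNhd ℝ G s := by
  have hω : ContDiffOn ℝ ω G s := by
    rw [contDiffOn_clm_apply]
    intro a
    rw [contDiffOn_clm_apply]
    intro b
    exact (h a b).contDiffOn_of_completeSpace
  exact hs.analyticOn_iff_analyticOnNhd.1 hω.analyticOn

end Components

/-! ### The analytic upgrade of a chart metric -/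

namespace OpensChart

variable {E : Type*} [NormedAddCommGroup E] [NormedSpace ℝ E] {U : Opens E} {n : ℕ∞ω}

/-- **A chart metric with analytic components is an analytic metric.** Let `g` be a `C^n`
pseudo-Riemannian metric on `U : Opens E` with representative
`G : E → (E →L E →L ℝ)` (`g.val y = G y` on `U`) real-analytic on `U`. Then there is a `C^ω`
pseudo-Riemannian metric on `U` (for the analytic structure of `U` as an open subset of `E`) with
the same values as `g` — hence (`leviCivita_congr_of_val_eq`) the same Levi-Civita connection,
curvature and Killing equation. Construction: the values, symmetry and nondegeneracy of `g`
verbatim; the bundle of bilinear forms over `U` is trivialised by the identity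
(`OpensChart.contMDiffAt_bilinSection_iff`), so `C^ω` regularity of the section is analyticity of
`G`. O'Neill 1983, Ch. 3, Def. 3.1 with Lemma 3.4 ff. (a metric is as regular as its components).
[cite: ONeill1983, Ch. 3, Def. 3.1] -/
theorem exists_analyticMetric_of_analyticOnNhd
    (g : PseudoRiemannianMetric 𝓘(ℝ, E) n E (TangentSpace 𝓘(ℝ, E) : U → Type _))
    {G : E → E →L[ℝ] E →L[ℝ] ℝ} (hG : ∀ y : U, g.val y = G y)
    (hA : AnalyticOnNhd ℝ G (U : Set E)) :
    ∃ g' : PseudoRiemannianMetric 𝓘(ℝ, E) ω E (TangentSpace 𝓘(ℝ, E) : U → Type _),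
      ∀ y : U, g'.val y = g.val y :=
  ⟨{ val := g.val
     symm := g.symm
     nondegenerate := g.nondegenerate
     contMDiff := fun y ↦ (contMDiffAt_bilinSection_iff y g.val G hG).2
       (hA y y.2).contDiffAt }, fun _ ↦ rfl⟩

/-- Componentwise form of `exists_analyticMetric_of_analyticOnNhd`: it suffices that every
component `p ↦ G p a b` be analytic on `U`. [cite: ONeill1983, Ch. 3, Def. 3.1] -/
theorem exists_analyticMetric_of_analyticOnNhd_apply₂ [FiniteDimensional ℝ E]
    (g : PseudoRiemannianMetric 𝓘(ℝ, E) n E (TangentSpace 𝓘(ℝ, E) : U → Type _))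
    {G : E → E →L[ℝ] E →L[ℝ] ℝ} (hG : ∀ y : U, g.val y = G y)
    (hA : ∀ a b : E, AnalyticOnNhd ℝ (fun p ↦ G p a b) (U : Set E)) :
    ∃ g' : PseudoRiemannianMetric 𝓘(ℝ, E) ω E (TangentSpace 𝓘(ℝ, E) : U → Type _),
      ∀ y : U, g'.val y = g.val y :=
  exists_analyticMetric_of_analyticOnNhd g hG (analyticOnNhd_bilin_of_apply₂ U.isOpen hA)

end OpensChart

end Literature.Geometry.Lorentzian

end
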